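/-
Copyright (c) 2026 the pub-hodgecm-mathlib formalisation cell (harness21).  Prover seat hodgecm-mathlib-K2Liu-p09 (g2): Track B «K2-LIT»,
#184♮ = hLiu418 = stmt-HodgeConjecture-24832, unit U5b «LOCAL SEAM OF s23», socket #29s `sig_K2LiuDoublingPartialEuler`, file (C0c):
transport of integrability along the splitting, the slice box formula, the box limit, and the abstract «multipliability by cases»; 2026-09-04.
-/
import Summits.HodgeConjecture.HodgeConjecture.Theorems.K2LiuDoublingEulerBox               -- ★ (C0b): the box formula (+ ★ (A))
import Literature.MeasureTheory.RestrictedProduct.ProductIntegralMonotone                    -- ★ `setLIntegral_rpBox_eq_prod`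
import Mathlib.Topology.Algebra.InfiniteSum.Basic
import HarnessLib

/-!
# Crux `HLiu418`, Track B road `K2_Liu`, unit U5b «LOCAL SEAM OF s23», socket #29s — file (C0c):
# TRANSPORT, SLICES, BOX LIMIT AND «MULTIPLIABILITY BY CASES»

Cell `hodgecm-mathlib`, crux item hLiu418 = `stmt-HodgeConjecture-24832`; squad K2 ∕ K2Liu, prover K2Liu-p09 (g2).  THEOREMS ONLY; lane
`--supports stmt-HodgeConjecture-24832` (helper for socket #29s `sig_K2LiuDoublingPartialEuler`).

* §1 (generic `F E c N J`) `integrable_glue_of_map_eq` — a `ν`-integrable continuous `F₀` on `U(J)(𝔸_F)` becomes, along a splitting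
  `(g ↦ (g_∞, g_S, g^S))_* ν = ν_∞ ⊗ (ν_S ⊗ ν^S)`, an integrable function of `((x_∞, x_S), y)` for `(ν_∞ ⊗ ν_S) ⊗ ν^S` (★ p04 `glue_eq_mul`);
  `setIntegral_rpBox_slice` — the SLICE BOX FORMULA `∫_{A_T} F₀((x_∞,1)(1,ι_S x_S)(1,ι^S y)) dν^S(y) = φ(pe x)·Q(pe x)·∏_{v∈T} c_v` for `F₀ = φ·Q` with (F)(Λ)(K)(E)
  (★ (C0b) `setIntegral_rpBox_eq` + `apply_pe_mul_jY_eq`); `slice_eq_of_forall_mem` — on the compact box `A_∅` the slice IS `φ(pe x)·Q(pe x)`.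
* §2 (generic restricted products) `tendsto_of_setIntegral_rpBox_eq` — box integrals of an integrable function converge to the full integral along `T ↑`
  (Mathlib `tendsto_setIntegral_of_monotone`, ★ `iUnion_rpBox_union`); `rpMeasure_rpBox_self` — the box `A_{S₀}` has mass `∏_{i∈S₀} ν_i(G_i)`-free form `= 1` for `S₀ = ∅`.
* §3 (abstract) `integral_eq_tprod_mul_integral_of_tendsto` — «MULTIPLIABILITY BY CASES»: if a.e. `h(x)·∏_{v∈T} c_v → I(x)`, then `∫ I = (∏' c)·∫ h`
  (one good `x₀` with `h(x₀) ≠ 0` makes `c` multipliable; otherwise both sides vanish); `exists_mem_integrable_slice` — a point of a non-null set with an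
  integrable slice (Fubini `Integrable.prod_left_ae`).
[Tate, Cassels–Fröhlich Ch. XV §3.3 Thm 3.3.1; Liu (2011) §2B Prop. 2.3 p. 862.]

HONEST LABEL.  Helper of socket #29s; by itself it retires no named input: `HC_CM` is proved only modulo the 7 printed citations (2 remaining named
inputs: hLiu418 = `stmt-HodgeConjecture-24832`, h413 = `stmt-HodgeConjecture-24833`) until rung 0 closes.
-/

set_option autoImplicit false
-- the mandated namespace repeats the single-problem summit's segment (`HodgeConjecture.HodgeConjecture`)
set_option linter.dupNamespace false

noncomputable section

open scoped RestrictedProduct ENNReal NNReal Topology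
open NumberField IsDedekindDomain MeasureTheory Measure Filter

namespace Summit.HodgeConjecture.HodgeConjecture.Cruxes.HLiu418.K2LiuDoublingEulerLimit

open Literature.NumberTheory.Automorphic
open Literature.NumberTheory.K2Lit.PlaceSplitting
open Literature.MeasureTheory.RestrictedProduct
open Summit.HodgeConjecture.HodgeConjecture.Cruxes.HLiu418.K2LiuAdelicPlaceSplittingFubini
open Summit.HodgeConjecture.HodgeConjecture.Cruxes.HLiu418.K2LiuDoublingZetaPlaceSplitting
open Summit.HodgeConjecture.HodgeConjecture.Cruxes.HLiu418.K2LiuDoublingEulerBox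

/-! ## §1 Transport of integrability along the splitting; the slice box formula -/

section Generic

variable (F E : Type) [Field F] [NumberField F] [Field E] [NumberField E] [Algebra F E]
  (c : E ≃ₐ[F] E) (N : ℕ) (J : Matrix (Fin N) (Fin N) E)
  (S : Finset (HeightOneSpectrum (𝓞 F))) [DecidableEq (HeightOneSpectrum (𝓞 F))]
  [MeasurableSpace (UnitaryGroup.adelicGroupData F E c N J).Adelic] [BorelSpace (UnitaryGroup.adelicGroupData F E c N J).Adelic]
  [MeasurableSpace (UnitaryGroup.arch F E c N J)] [BorelSpace (UnitaryGroup.arch F E c N J)]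
  [∀ v : HeightOneSpectrum (𝓞 F), MeasurableSpace (UnitaryGroup.localPi E c N J v)]
  [∀ v : HeightOneSpectrum (𝓞 F), BorelSpace (UnitaryGroup.localPi E c N J v)]

/-- **Transport of integrability along the splitting.**  If `(g ↦ (g_∞, (g_S, g^S)))_* ν = ν_∞ ⊗ (ν_S ⊗ ν^S)` and `F₀` is continuous and `ν`-integrable on
`U(J)(𝔸_F)`, then `((x_∞, x_S), y) ↦ F₀((x_∞,1)(1,ι_S x_S)(1,ι^S y))` is integrable for `(ν_∞ ⊗ ν_S) ⊗ ν^S` (the gluing inverts the splitting, ★ p04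
`glue_eq_mul`; Mathlib `MeasurePreserving.integrable_comp`, `measurePreserving_prodAssoc`). [cite: BorelJacquet1979, §4.1] [cite: CasselsFrohlichANT1967, Ch. XV (Tate) §3.3] -/
theorem integrable_glue_of_map_eq (ν : Measure (UnitaryGroup.adelicGroupData F E c N J).Adelic)
    (νinf : Measure (UnitaryGroup.arch F E c N J)) (νS : Measure (Π v : S, UnitaryGroup.localPi E c N J v.1))
    (νoff : Measure (Πʳ v : {v // v ∉ S}, [UnitaryGroup.localPi E c N J v.1, UnitaryGroup.localInt E c N J v.1]))
    [SigmaFinite νinf] [SigmaFinite νS] [SigmaFinite νoff]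
    (hmap : Measure.map (fun g => (UnitaryGroup.archPart F E c N J g, splitPlaces F E c N J S (UnitaryGroup.finPart F E c N J g))) ν =
      νinf.prod (νS.prod νoff))
    (F₀ : (UnitaryGroup.adelicGroupData F E c N J).Adelic → ℂ) (hF₀c : Continuous F₀) (hF₀i : Integrable F₀ ν) :
    Integrable (fun p : (UnitaryGroup.arch F E c N J × (Π v : S, UnitaryGroup.localPi E c N J v.1)) ×
        (Πʳ v : {v // v ∉ S}, [UnitaryGroup.localPi E c N J v.1, UnitaryGroup.localInt E c N J v.1]) =>
      F₀ (UnitaryGroup.archToAdelic F E c N J p.1.1 *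
        UnitaryGroup.finAdelicToAdelic F E c N J ((splitPlaces F E c N J S).symm (p.1.2, 1)) *
          UnitaryGroup.finAdelicToAdelic F E c N J ((splitPlaces F E c N J S).symm (1, p.2)))) ((νinf.prod νS).prod νoff) := by
  haveI : Countable (HeightOneSpectrum (𝓞 F)) := countable_heightOneSpectrum F
  haveI : ∀ v, SecondCountableTopology (UnitaryGroup.localPi E c N J v) := fun v => UnitaryGroup.secondCountableTopology_localPi E N c J v
  haveI := fact_isOpen_off (fun v => UnitaryGroup.localPi E c N J v) (fun v => UnitaryGroup.localInt E c N J v) S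
  haveI := borelSpace_off (fun v => UnitaryGroup.localPi E c N J v) (fun v => UnitaryGroup.localInt E c N J v) S
  haveI := secondCountableTopology_off (fun v => UnitaryGroup.localPi E c N J v) (fun v => UnitaryGroup.localInt E c N J v) S
  haveI hS2 : SecondCountableTopology (Π v : S, UnitaryGroup.localPi E c N J v.1) := inferInstance
  haveI : SecondCountableTopologyEither (Π v : S, UnitaryGroup.localPi E c N J v.1)
      (Πʳ v : {v // v ∉ S}, [UnitaryGroup.localPi E c N J v.1, UnitaryGroup.localInt E c N J v.1]) := secondCountableTopologyEither_of_left _ _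
  haveI : BorelSpace ((Π v : S, UnitaryGroup.localPi E c N J v.1) ×
      (Πʳ v : {v // v ∉ S}, [UnitaryGroup.localPi E c N J v.1, UnitaryGroup.localInt E c N J v.1])) := Prod.borelSpace
  haveI : SecondCountableTopologyEither (UnitaryGroup.arch F E c N J) ((Π v : S, UnitaryGroup.localPi E c N J v.1) ×
      (Πʳ v : {v // v ∉ S}, [UnitaryGroup.localPi E c N J v.1, UnitaryGroup.localInt E c N J v.1])) := secondCountableTopologyEither_of_left _ _
  haveI : BorelSpace (UnitaryGroup.arch F E c N J × ((Π v : S, UnitaryGroup.localPi E c N J v.1) ×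
      (Πʳ v : {v // v ∉ S}, [UnitaryGroup.localPi E c N J v.1, UnitaryGroup.localInt E c N J v.1]))) := Prod.borelSpace
  have hE₃ : MeasurePreserving (fun g : (UnitaryGroup.adelicGroupData F E c N J).Adelic =>
      (UnitaryGroup.archPart F E c N J g, splitPlaces F E c N J S (UnitaryGroup.finPart F E c N J g))) ν (νinf.prod (νS.prod νoff)) :=
    ⟨((UnitaryGroup.continuous_archPart F E c N J).prodMk
      ((splitPlaces F E c N J S).continuous.comp (UnitaryGroup.continuous_finPart F E c N J))).measurable, hmap⟩
  have hG3c : Continuous fun z : UnitaryGroup.arch F E c N J × ((Π v : S, UnitaryGroup.localPi E c N J v.1) ×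
      (Πʳ v : {v // v ∉ S}, [UnitaryGroup.localPi E c N J v.1, UnitaryGroup.localInt E c N J v.1])) =>
      F₀ (UnitaryGroup.archToAdelic F E c N J z.1 * UnitaryGroup.finAdelicToAdelic F E c N J ((splitPlaces F E c N J S).symm (z.2.1, 1)) *
        UnitaryGroup.finAdelicToAdelic F E c N J ((splitPlaces F E c N J S).symm (1, z.2.2))) := by
    refine hF₀c.comp ((((UnitaryGroup.continuous_archToAdelic F E c N J).comp continuous_fst).mul
      ((UnitaryGroup.continuous_finAdelicToAdelic F E c N J).comp ((splitPlaces F E c N J S).symm.continuous.comp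
        ((continuous_fst.comp continuous_snd).prodMk continuous_const)))).mul
      ((UnitaryGroup.continuous_finAdelicToAdelic F E c N J).comp ((splitPlaces F E c N J S).symm.continuous.comp
        (continuous_const.prodMk (continuous_snd.comp continuous_snd)))))
  have hG3 : Integrable (fun z : UnitaryGroup.arch F E c N J × ((Π v : S, UnitaryGroup.localPi E c N J v.1) ×
      (Πʳ v : {v // v ∉ S}, [UnitaryGroup.localPi E c N J v.1, UnitaryGroup.localInt E c N J v.1])) =>
      F₀ (UnitaryGroup.archToAdelic F E c N J z.1 * UnitaryGroup.finAdelicToAdelic F E c N J ((splitPlaces F E c N J S).symm (z.2.1, 1)) *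
        UnitaryGroup.finAdelicToAdelic F E c N J ((splitPlaces F E c N J S).symm (1, z.2.2)))) (νinf.prod (νS.prod νoff)) := by
    refine (hE₃.integrable_comp hG3c.aestronglyMeasurable).1 (hF₀i.congr (Eventually.of_forall fun g => ?_))
    show F₀ g = F₀ (UnitaryGroup.archToAdelic F E c N J (UnitaryGroup.archPart F E c N J g) *
      UnitaryGroup.finAdelicToAdelic F E c N J ((splitPlaces F E c N J S).symm
        ((splitPlaces F E c N J S (UnitaryGroup.finPart F E c N J g)).1, 1)) *
      UnitaryGroup.finAdelicToAdelic F E c N J ((splitPlaces F E c N J S).symm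
        (1, (splitPlaces F E c N J S (UnitaryGroup.finPart F E c N J g)).2)))
    rw [← glue_eq_mul, Prod.mk.eta, ContinuousMulEquiv.symm_apply_apply, ← UnitaryGroup.adelicProdEquiv_apply,
      ContinuousMulEquiv.symm_apply_apply]
  exact ((MeasureTheory.measurePreserving_prodAssoc νinf νS νoff).integrable_comp_emb MeasurableEquiv.prodAssoc.measurableEmbedding).2 hG3

omit [MeasurableSpace (UnitaryGroup.arch F E c N J)] [BorelSpace (UnitaryGroup.arch F E c N J)] in
/-- **The slice box formula.**  `F₀ = φ · Q` with `φ` of shape (F) (`φ(t) = FS(t_∞, t_S) ∏ᶠ_{v∉S} Λ_v(t_v)`, `Λ_v|K_v = 1`), `Q` bounded measurable with (K) and the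
local Hecke identities (E) off `S`; then for every `x = (x_∞, x_S)` and every finite `T ⊆ {v ∉ S}`:
`∫_{A_T} F₀((x_∞,1)(1,ι_S x_S)(1,ι^S y)) d∏'(ν_v;K_v)(y) = φ(pe x) · Q(pe x) · ∏_{v∈T} c_v`, `pe x = (x_∞,1)(1,ι_S x_S)`.
[cite: CasselsFrohlichANT1967, Ch. XV (Tate) §3.3 Thm. 3.3.1] [cite: Liu2011, §2B Prop. 2.3 p. 862] -/
theorem setIntegral_rpBox_slice (φ Q : (UnitaryGroup.adelicGroupData F E c N J).Adelic → ℂ) (hQm : Measurable Q) {CQ : ℝ} (hQb : ∀ g, ‖Q g‖ ≤ CQ)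
    (hK : ∀ t k : (UnitaryGroup.adelicGroupData F E c N J).Adelic, UnitaryGroup.archPart F E c N J k = 1 →
      (∀ v, UnitaryGroup.evalPlace F E c N J v (UnitaryGroup.finPart F E c N J k) ∈ UnitaryGroup.localInt E c N J v) →
      (∀ v ∈ S, UnitaryGroup.evalPlace F E c N J v (UnitaryGroup.finPart F E c N J k) = 1) → Q (t * k) = Q t)
    (νv : ∀ v : HeightOneSpectrum (𝓞 F), Measure (UnitaryGroup.localPi E c N J v)) [∀ v, (νv v).IsHaarMeasure]
    (hνK : ∀ v, v ∉ S → νv v (UnitaryGroup.localInt E c N J v : Set (UnitaryGroup.localPi E c N J v)) = 1)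
    (FS : UnitaryGroup.arch F E c N J × (Π v : S, UnitaryGroup.localPi E c N J v.1) → ℂ)
    (Λ : ∀ v : HeightOneSpectrum (𝓞 F), UnitaryGroup.localPi E c N J v → ℂ)
    (hF : ∀ t : (UnitaryGroup.adelicGroupData F E c N J).Adelic, φ t = FS (UnitaryGroup.archPart F E c N J t,
        fun v : S => UnitaryGroup.evalPlace F E c N J v.1 (UnitaryGroup.finPart F E c N J t)) *
      ∏ᶠ v : {v : HeightOneSpectrum (𝓞 F) // v ∉ S}, Λ v.1 (UnitaryGroup.evalPlace F E c N J v.1 (UnitaryGroup.finPart F E c N J t)))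
    (hΛK : ∀ v, v ∉ S → ∀ k ∈ UnitaryGroup.localInt E c N J v, Λ v k = 1)
    (hΛint : ∀ v, v ∉ S → Integrable (Λ v) (νv v)) (cv : HeightOneSpectrum (𝓞 F) → ℂ)
    (hE : ∀ v, v ∉ S → ∀ t : (UnitaryGroup.adelicGroupData F E c N J).Adelic,
      ∫ g, Λ v g * Q (t * UnitaryGroup.inclPlaceAdelic F E c N J v g) ∂(νv v) = cv v * Q t)
    (x : UnitaryGroup.arch F E c N J × (Π v : S, UnitaryGroup.localPi E c N J v.1)) (T : Finset {v : HeightOneSpectrum (𝓞 F) // v ∉ S}) :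
    ∫ y in rpBox (fun v : {v : HeightOneSpectrum (𝓞 F) // v ∉ S} => (UnitaryGroup.localInt E c N J v.1 : Set (UnitaryGroup.localPi E c N J v.1))) T,
        φ (UnitaryGroup.archToAdelic F E c N J x.1 * UnitaryGroup.finAdelicToAdelic F E c N J ((splitPlaces F E c N J S).symm (x.2, 1)) *
            UnitaryGroup.finAdelicToAdelic F E c N J ((splitPlaces F E c N J S).symm (1, y))) *
          Q (UnitaryGroup.archToAdelic F E c N J x.1 * UnitaryGroup.finAdelicToAdelic F E c N J ((splitPlaces F E c N J S).symm (x.2, 1)) *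
            UnitaryGroup.finAdelicToAdelic F E c N J ((splitPlaces F E c N J S).symm (1, y)))
      ∂(rpMeasure (fun v : {v : HeightOneSpectrum (𝓞 F) // v ∉ S} => (UnitaryGroup.localInt E c N J v.1 : Set (UnitaryGroup.localPi E c N J v.1)))
        (fun v => νv v.1) ∅) =
      φ (UnitaryGroup.archToAdelic F E c N J x.1 * UnitaryGroup.finAdelicToAdelic F E c N J ((splitPlaces F E c N J S).symm (x.2, 1))) *
        Q (UnitaryGroup.archToAdelic F E c N J x.1 * UnitaryGroup.finAdelicToAdelic F E c N J ((splitPlaces F E c N J S).symm (x.2, 1))) *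
          ∏ v ∈ T, cv v.1 := by
  have hsl : ∀ y : (Πʳ v : {v // v ∉ S}, [UnitaryGroup.localPi E c N J v.1, UnitaryGroup.localInt E c N J v.1]),
      φ (UnitaryGroup.archToAdelic F E c N J x.1 * UnitaryGroup.finAdelicToAdelic F E c N J ((splitPlaces F E c N J S).symm (x.2, 1)) *
          UnitaryGroup.finAdelicToAdelic F E c N J ((splitPlaces F E c N J S).symm (1, y))) *
        Q (UnitaryGroup.archToAdelic F E c N J x.1 * UnitaryGroup.finAdelicToAdelic F E c N J ((splitPlaces F E c N J S).symm (x.2, 1)) *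
          UnitaryGroup.finAdelicToAdelic F E c N J ((splitPlaces F E c N J S).symm (1, y))) =
      φ (UnitaryGroup.archToAdelic F E c N J x.1 * UnitaryGroup.finAdelicToAdelic F E c N J ((splitPlaces F E c N J S).symm (x.2, 1))) *
        ((∏ᶠ v : {v : HeightOneSpectrum (𝓞 F) // v ∉ S}, Λ v.1 (y v)) *
          Q (UnitaryGroup.archToAdelic F E c N J x.1 * UnitaryGroup.finAdelicToAdelic F E c N J ((splitPlaces F E c N J S).symm (x.2, 1)) *
            UnitaryGroup.finAdelicToAdelic F E c N J ((splitPlaces F E c N J S).symm (1, y)))) := fun y => by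
    rw [apply_pe_mul_jY_eq F E c N J S φ FS Λ hF hΛK x.1 x.2 y, mul_assoc]
  simp_rw [hsl]
  rw [integral_const_mul, setIntegral_rpBox_eq F E c N J S Q hQm hQb hK νv hνK Λ hΛK hΛint cv hE T]
  ring

omit [MeasurableSpace (UnitaryGroup.adelicGroupData F E c N J).Adelic] [BorelSpace (UnitaryGroup.adelicGroupData F E c N J).Adelic]
  [MeasurableSpace (UnitaryGroup.arch F E c N J)] [BorelSpace (UnitaryGroup.arch F E c N J)]
  [∀ v, MeasurableSpace (UnitaryGroup.localPi E c N J v)] [∀ v, BorelSpace (UnitaryGroup.localPi E c N J v)] in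
/-- **The slice on the compact box.**  For `y` with all components in `K_v`: `F₀((x_∞,1)(1,ι_S x_S)(1,ι^S y)) = φ(pe x) · Q(pe x)` ((F) with `Λ_v|K_v = 1`, and (K)).
[cite: Liu2011, §2B Prop. 2.3 p. 862] -/
theorem slice_eq_of_forall_mem (φ Q : (UnitaryGroup.adelicGroupData F E c N J).Adelic → ℂ)
    (hK : ∀ t k : (UnitaryGroup.adelicGroupData F E c N J).Adelic, UnitaryGroup.archPart F E c N J k = 1 →
      (∀ v, UnitaryGroup.evalPlace F E c N J v (UnitaryGroup.finPart F E c N J k) ∈ UnitaryGroup.localInt E c N J v) →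
      (∀ v ∈ S, UnitaryGroup.evalPlace F E c N J v (UnitaryGroup.finPart F E c N J k) = 1) → Q (t * k) = Q t)
    (FS : UnitaryGroup.arch F E c N J × (Π v : S, UnitaryGroup.localPi E c N J v.1) → ℂ)
    (Λ : ∀ v : HeightOneSpectrum (𝓞 F), UnitaryGroup.localPi E c N J v → ℂ)
    (hF : ∀ t : (UnitaryGroup.adelicGroupData F E c N J).Adelic, φ t = FS (UnitaryGroup.archPart F E c N J t,
        fun v : S => UnitaryGroup.evalPlace F E c N J v.1 (UnitaryGroup.finPart F E c N J t)) *
      ∏ᶠ v : {v : HeightOneSpectrum (𝓞 F) // v ∉ S}, Λ v.1 (UnitaryGroup.evalPlace F E c N J v.1 (UnitaryGroup.finPart F E c N J t)))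
    (hΛK : ∀ v, v ∉ S → ∀ k ∈ UnitaryGroup.localInt E c N J v, Λ v k = 1)
    (x : UnitaryGroup.arch F E c N J × (Π v : S, UnitaryGroup.localPi E c N J v.1))
    (y : (Πʳ v : {v // v ∉ S}, [UnitaryGroup.localPi E c N J v.1, UnitaryGroup.localInt E c N J v.1]))
    (hy : ∀ v, y v ∈ UnitaryGroup.localInt E c N J v.1) :
    φ (UnitaryGroup.archToAdelic F E c N J x.1 * UnitaryGroup.finAdelicToAdelic F E c N J ((splitPlaces F E c N J S).symm (x.2, 1)) *
          UnitaryGroup.finAdelicToAdelic F E c N J ((splitPlaces F E c N J S).symm (1, y))) *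
        Q (UnitaryGroup.archToAdelic F E c N J x.1 * UnitaryGroup.finAdelicToAdelic F E c N J ((splitPlaces F E c N J S).symm (x.2, 1)) *
          UnitaryGroup.finAdelicToAdelic F E c N J ((splitPlaces F E c N J S).symm (1, y))) =
      φ (UnitaryGroup.archToAdelic F E c N J x.1 * UnitaryGroup.finAdelicToAdelic F E c N J ((splitPlaces F E c N J S).symm (x.2, 1))) *
        Q (UnitaryGroup.archToAdelic F E c N J x.1 * UnitaryGroup.finAdelicToAdelic F E c N J ((splitPlaces F E c N J S).symm (x.2, 1))) := by
  have h1 := apply_pe_mul_jY_eq F E c N J S φ FS Λ hF hΛK x.1 x.2 y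
  have h2 := apply_mul_jY_eq_of_forall_mem F E c N J S Q hK y hy
    (UnitaryGroup.archToAdelic F E c N J x.1 * UnitaryGroup.finAdelicToAdelic F E c N J ((splitPlaces F E c N J S).symm (x.2, 1)))
  have h3 : (∏ᶠ v : {v : HeightOneSpectrum (𝓞 F) // v ∉ S}, Λ v.1 (y v)) = 1 := finprod_eq_one_of_forall_eq_one (fun v => hΛK v.1 v.2 _ (hy v))
  simp only [h1, h2, h3, mul_one]

end Generic

/-! ## §2 Generic restricted products: the box limit and the mass of the compact box -/

section Restricted

variable {ι : Type} {G : ι → Type} [∀ i, MeasurableSpace (G i)] [Countable ι]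
  (K : ∀ i, Set (G i)) (ν : ∀ i, Measure (G i)) [∀ i, SigmaFinite (ν i)]

omit [∀ i, SigmaFinite (ν i)] in
/-- **Box limit.**  If `f` is integrable for `μ = ∏'(ν_i; K_i)` (exceptional set `∅`) and its box integrals are known, `∫_{A_T} f dμ = a T`, then `a T ⟶ ∫ f dμ` along
`T ↑` (Mathlib `tendsto_setIntegral_of_monotone`; `⋃_T A_T` is everything, ★ `iUnion_rpBox_union`). [cite: CasselsFrohlichANT1967, Ch. XV (Tate) §3.3 Thm. 3.3.1] -/
theorem tendsto_of_setIntegral_rpBox_eq (hKm : ∀ i, MeasurableSet (K i)) {f : (Πʳ i, [G i, K i]) → ℂ} (hf : Integrable f (rpMeasure K ν ∅))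
    {a : Finset ι → ℂ} (ha : ∀ T : Finset ι, ∫ y in rpBox K T, f y ∂(rpMeasure K ν ∅) = a T) :
    Tendsto a atTop (𝓝 (∫ y, f y ∂(rpMeasure K ν ∅))) := by
  classical
  have hmono : Monotone fun T : Finset ι => rpBox K (∅ ∪ T) := fun T T' hTT' => rpBox_mono K (Finset.union_subset_union le_rfl hTT')
  have ht := tendsto_setIntegral_of_monotone (μ := rpMeasure K ν ∅) (f := f) (fun T => measurableSet_rpBox K hKm (∅ ∪ T)) hmono
    (by rw [iUnion_rpBox_union K ∅]; exact hf.integrableOn)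
  rw [iUnion_rpBox_union K ∅, Measure.restrict_univ] at ht
  refine ht.congr fun T => ?_
  rw [Finset.empty_union, ha]

/-- **The compact box `A_∅ = Π_i K_i` has mass one** for `∏'(ν_i; K_i)` when every `ν_i(K_i) = 1`. [cite: CasselsFrohlichANT1967, Ch. XV (Tate) §3.3] -/
theorem rpMeasure_rpBox_empty (hKne : ∀ i, (K i).Nonempty) (hKm : ∀ i, MeasurableSet (K i)) (hK1 : ∀ i, ν i (K i) = 1) :
    rpMeasure K ν ∅ (rpBox K ∅) = 1 := by
  rw [← setLIntegral_one, setLIntegral_rpBox_eq_prod K ν hKne hKm (S₀ := ∅) (fun i _ => hK1 i) (fun _ _ => 1) (fun _ => measurable_const)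
    (fun _ => 1) (Finset.Subset.refl ∅) (fun _ _ => by rw [Finset.prod_empty]), Finset.prod_empty]

end Restricted

/-! ## §3 Abstract: «multipliability by cases» and a point with an integrable slice -/

section Abstract

variable {X : Type} [MeasurableSpace X] {μ : Measure X} {ι : Type}

/-- **«MULTIPLIABILITY BY CASES».**  Let `I h : X → ℂ`, `c : ι → ℂ`, and suppose that for `μ`-a.e. `x` the partial products `h(x) · ∏_{v∈T} c_v` converge to `I(x)`
along `T ↑`.  Then `∫ I dμ = (∏' c) · ∫ h dμ`: if `h(x₀) ≠ 0` at one such `x₀`, the `∏_{v∈T} c_v` converge (`HasProd`), `∏'` is their limit and `I = (∏' c)·h`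
a.e.; otherwise `h = 0` a.e., so `I = 0` a.e. and both sides vanish (the junk value of `∏'` is harmless). [cite: CasselsFrohlichANT1967, Ch. XV (Tate) §3.3 Thm. 3.3.1] -/
theorem integral_eq_tprod_mul_integral_of_tendsto (I h : X → ℂ) (c : ι → ℂ) {P : X → Prop} (hP : ∀ᵐ x ∂μ, P x)
    (hlim : ∀ x, P x → Tendsto (fun T : Finset ι => h x * ∏ v ∈ T, c v) atTop (𝓝 (I x))) :
    ∫ x, I x ∂μ = (∏' v, c v) * ∫ x, h x ∂μ := by
  by_cases hcase : ∃ x, P x ∧ h x ≠ 0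
  · obtain ⟨x₀, hx₀P, hx₀⟩ := hcase
    have hprod : HasProd c (I x₀ / h x₀) := by
      refine ((hlim x₀ hx₀P).div_const (h x₀)).congr fun T => ?_
      rw [mul_div_cancel_left₀ _ hx₀]
    have hI : ∀ᵐ x ∂μ, I x = (∏' v, c v) * h x := hP.mono fun x hx => by
      rw [hprod.tprod_eq, mul_comm]
      exact tendsto_nhds_unique (hlim x hx) (hprod.const_mul (h x))
    rw [integral_congr_ae hI, integral_const_mul]
  · simp only [not_exists, not_and, ne_eq, not_not] at hcase
    have hI : ∀ᵐ x ∂μ, I x = 0 := hP.mono fun x hx => by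
      have ht := hlim x hx
      rw [hcase x hx] at ht
      simp_rw [zero_mul] at ht
      exact tendsto_nhds_unique ht tendsto_const_nhds
    have hh0 : ∀ᵐ x ∂μ, h x = 0 := hP.mono hcase
    rw [integral_congr_ae hI, integral_congr_ae hh0]
    simp

/-- **A point of a non-null set with an integrable slice.**  If `G` is integrable for `μ ⊗ ρ` and `ρ B ≠ 0`, some `y ∈ B` has `x ↦ G(x, y)` integrable
(Fubini: a.e. slice is integrable, Mathlib `Integrable.prod_left_ae`). [cite: CasselsFrohlichANT1967, Ch. XV (Tate) §3.3] -/
theorem exists_mem_integrable_slice {Y : Type} [MeasurableSpace Y] {ρ : Measure Y} [SFinite ρ] [SFinite μ]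
    {G : X × Y → ℂ} (hG : Integrable G (μ.prod ρ)) {B : Set Y} (hBm : MeasurableSet B) (hB : ρ B ≠ 0) :
    ∃ y, y ∈ B ∧ Integrable (fun x => G (x, y)) μ := by
  have hsl : ∀ᵐ y ∂ρ, Integrable (fun x => G (x, y)) μ := hG.prod_left_ae
  haveI : (ae (ρ.restrict B)).NeBot := by
    rw [ae_neBot, Ne, Measure.restrict_eq_zero]; exact hB
  exact ((ae_restrict_mem hBm).and (ae_restrict_of_ae hsl)).exists

end Abstract

end Summit.HodgeConjecture.HodgeConjecture.Cruxes.HLiu418.K2LiuDoublingEulerLimit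

end
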